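import Summits.BirchSwinnertonDyer.Rank1Residual.F1Sign2.KernelLetterCarrierAtTwo
import Literature.NumberTheory.EllipticCurves.ModularJacobianGaloisDataWithFormsAndPairing
import HarnessLib.Audit.Tags
import HarnessLib

/-!
# Cell `bsd-f1-sign2` — typer file for crux C1 `MainConjectureTransportAlignedAtTwo` (stmt-BirchSwinnertonDyer-22296): the ODD-LEVEL
# kernel-letter carrier in its `∃`-form over the JOINT `ℚ`-structure — the binder `hKLCLo` of the C1 composition files, NAMED

STATEMENT ONLY (one `@[conjecture] def … : Prop` over tree declarations; nothing asserted, no `sorry`, no instance; BSD is not proved by this,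
C1 is not closed by this).  TYPING ASK of width seat `bsd-line-att-p4` g20 (HOME/INBOX 2026-08-29T17:49:37Z and HOME/HANDOFF «-line-att-p4 g20»,
SUCCESSOR (b): «-ty: name hKLCLo's ∃-form (then the ledger is fully by-name: PRINT¹⁰ + four named nodes)»); the analogue of -ty g18's naming of
`hM2L` as `F1Sign2.MultiplicityTwoAtLevelAtTwo` (`F1Sign2/CopyAlignmentAtTwo.lean`, p728630).

WHAT IS NAMED.  The C1 composition files of the `AlignedTransportAtTwo` route consume, besides PRINT facts and `F1Sign2.MultiplicityTwoAtLevelAtTwo`,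
exactly ONE more non-print input, always with the same binder (att-p5 g22 `…KilfordKernelLetterOfFactsAtOddLevel` §1–§3, p727366; re-keyed
`…KilfordKernelLetterOfNamedFactsAtOddLevel`, p734451; att-p4 g20's ROUTE LEDGER `Theorems/AlignedTransportAtTwoRouteLedger.lean` §1–§3, p735839, and
`…RouteLedgerCertified.lean`, p735967; LINE v31 skeleton `Cruxes/MainConjectureTransportAlignedAtTwo/Lines/birth_v31_proposal_att_p4g20.lean`, stub
`stub_kernelLetterCarrierAtOddLevel`):

  `hKLCLo : ∀ (L : ℕ) [NeZero L], ¬ 2 ∣ L → ∀ (ι : AlgebraicClosure ℚ →+* ℂ),`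
  `  ∃ Dj : ModularJacobianGaloisDataWithFormsAndPairing L ι, KernelLetterCarrierAtLevelAtTwo L ι Dj.toModularJacobianGaloisDataWithPairing`

— for every ODD level `L` and every `ι : ℚ̄ → ℂ`, SOME joint `ℚ`-structure `Dj` of `J₀(L)` (ONE `galAct` with forms-equivariance of every lattice-compatible
rational form's Jacobi map AND the `𝕋_ℤ`-balanced, perfect, symmetric, `galAct`-invariant `w_L`-twisted Weil pairing on `J₀(L)[2]`: the typer's Literature
structure `ModularJacobianGaloisDataWithFormsAndPairing L ι`, p701751) carries -ty g15's level-`L` kernel-letter carrier `KernelLetterCarrierAtLevelAtTwo L ι ·`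
(`F1Sign2/KernelLetterCarrierAtTwo.lean`, p703757: (W0′-forms) functoriality of the connected part of `J₀(L)[2]` under every such Jacobi map to a good-ordinary
`W`, and (W1)_L Wiese's Situation II socle row — `⊥`-closed multiplicative part, socle set of `8 = 2^{2r−1}` — inside `U = J₀(L)[𝔪]` for every two-element-quotient
eigen-ideal `𝔪` of a Kilford-stratum curve, under the multiplicity-two hypothesis `finrank_{𝕋/𝔪} J₀(L)[𝔪] = 4`).  The `Prop` below is that binder, byte-identical,
closed into a `def`; it unfolds definitionally, so every consumer above is fed BY NAME with no glue (as `MultiplicityTwoAtLevelAtTwo` feeds `hM2L` in p734451/p735839).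

QUANTIFIER SHAPE (why `∃ Dj`, why `¬ 2 ∣ L →`).  (i) `ModularJacobianGaloisDataWithFormsAndPairing` is a HYPOTHESIS structure with no uniqueness; the
existence of SOME inhabitant for every `L`, `ι` is the named PRINT fact `exists_modularJacobianGaloisDataWithFormsAndPairing_eichlerShimura`
[cite: DarmonDiamondTaylor1995, Thm. 1.29 (p. 37), §1.5 (p. 38), §1.6 Lemma 1.38 (p. 41), §1.7 Def. 1.44 and Lemma 1.46 (p. 44–45), §4.4 (4.4.2)]
[cite: ShimuraIATAF1971, Thm. 7.9, Thm. 7.14]; the conjecture is that the carrier rows hold for (at least) ONE such datum — the intended witness is THE Galois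
action on `J₀(L)(ℚ̄)_tors` transported along `ι` with the `w_L`-twisted Weil pairing mod `2` and `M = J₀(L)[2]⁰` (connected part at the `2`-adic place of
`reductionDatum`) — and the consumers use the datum ONCE, at the odd level `L = lcm(N(W₁), N(W₂))` resp. `L = N`, through `obtain ⟨Dj, hcarrier⟩ := hKLCLo L hL2 ι`
(REF1-AUDIT §186: «the ∃-form is SOUND and consumed once, at the right level, from ONE datum»).  It is WEAKER than the `∀ J`-form of LINE v28's
`stub_kernelLetterCarrierAtTwo : ∀ N ι (J : ModularJacobianGaloisDataWithPairing N ι), KernelLetterCarrierAtTwo N ι J` (which posits the rows for EVERY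
hypothesis datum, junk pairings included).  (ii) The restriction to ODD `L` is forced: `KernelLetterCarrierAtLevelAtTwo L ι J` begins `¬ 2 ∣ L ∧ …` and is
FALSE at even `L` by design (REF1-AUDIT §181 T181d: «never file the ∀L-closure of AtLevel as an item»); the binder's `¬ 2 ∣ L →` is exactly that guard
(the cell's curves are good ordinary at `2`, so every level met — conductors, their `lcm`, `M·q` — is odd).

GRADE / PLACEMENT.  Conjecture-grade (`@[conjecture]`), with EXACTLY the gap (γ) of `KernelLetterCarrierAtTwo` / `KernelLetterCarrierAtLevelAtTwo`
(REF1-AUDIT §177 (c), §181 Part B): (γ)(i) the `J₁(L)`/`Γ₁(L)`-algebra → `J₀(L)`/`𝕋` transfer of Wiese's Situation II («`p` any prime, level prime to `p`,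
`𝔪` ordinary, `ρ_𝔪` irreducible») at an ordinary non-Eisenstein `𝔪 ∣ 2` [cite: Wiese2007Multiplicities, Situation II, Thm. 2.1, Prop. 2.2, Cor. 4.2], and
(γ)(ii) the value `r = 2`, which (W1)_L takes as a HYPOTHESIS at `(L, 𝔪)` (it is the separate named node `MultiplicityTwoAtLevelAtTwo`;
[cite: KilfordWiese2008, Thm. 1.3, Cor. 1.6, Question 1.9] — open at `p = 2` on the dihedral `S₃` stratum, answered for odd `p` by
[cite: CalegariGeraghty2018, Thm. 3.25, Rem. 3.26, Rem. 3.31]); (W0′-forms) and `⊥`-closedness are THEOREM-grade folklore for the natural model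
`M = J₀(L)[2]⁰` (Néron mapping property, «connected ↦ connected»; Cartier duality [cite: Gross1990, p. 485, Props. 12.8–12.9]).  In print: the rows at every
level prime to `2` in the `J₁` setting; NOT in print: the transfer (i) and `r = 2` (ii).  Beyond-print theorem: no.  PARTITION: none moved.

CENSUS (BC5 witness; inherited from the carrier it closes, numbers not adjectives): att-p5 g17 H12/P14/PLANES 74/74; att-p5 g18 cross-level 43/43
(«aligned ⟹ D(C₁) = C₂» 12/12, «misaligned ⟹ planes meet in 0» 31/31, `dim J₀(N₂)[𝔪₂] = 4` 17/17); att-p5 g19 fifth engine (SOCLE memo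
`Cruxes/MainConjectureTransportAlignedAtTwo/SOCLE-att-p5-g19.md`): 36/36 odd stratum `(N, 𝔪)` incl. 24 composite `N` — `T̄_𝔪` faithful, `dim soc T̄_𝔪 = 3`
(`#soc = 8`), `dim J₀(N)[𝔪] = 4`, `soc(T̄_𝔪)·J[2]_𝔪 = J[𝔪]` 33/33; att-p3 g20 127/127 incl. exotic ideals; scalar level raising `17671 = 41·431` `d = 4`.
`lcm`-SHAPE COMMON LEVELS (the row's former «untested cell»): RUN for `d` at all five ALIGN3 `lcm` levels with `ψ ≤ 64 000` — `d = 4`, 5/5; socle `s` there not run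
(att-p3 g22, INBOX 2026-08-29T18:19Z / 18:51Z / 19:00Z, memo v6 `Cruxes/MainConjectureTransportAlignedAtTwo/LEVEL-LOWERED-att-p3-g22.md` commit 3812264d5635, rows JSON v5
on 22296): `39221`, `42755`, `36939 = 3·7·1759 = lcm(5277, 12313)`, `47785 = 5·19·503 = lcm(2515, 9557)` (misaligned pairs) and `41979 = 3·7·1999 = lcm(5997, 13993)`
(an ALIGNED pair `5997a1 ~ 13993a1` — a v31-consumed instance); each carries exactly ONE `𝔽₂`-maximal ideal above the character (the class is ramified at the large prime
`Q ∈ {431, 503, 1759, 1999}`, forcing `U_Q ≡ 1`), with `d = dim J₀(L)[𝔪] = 4` at it (e.g. 41979: anemic eigenspace 16 → `U₃ ≡ 1`: 8 → `U₇ ≡ 1`: 4); non-canonical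
`U_q`-patterns EMPTY where run (9/9) — so the multiplicity hypothesis of (W1)_L is witnessed at `lcm`-shape levels and only the socle-`8` conclusion there remains untested.  CHEAPEST FALSIFIER: an odd level `L`, a Kilford-stratum `W`
and a two-element-quotient eigen-ideal `𝔪 ⊆ 𝕋_ℤ(L)` of `W` with `dim J₀(L)[𝔪] = 4` but `#(J₀(L)[2]⁰ ∩ J₀(L)[𝔪]) ≠ 8`, or a non-isotropic multiplicative part
on that ordinary `𝔪`-component — none in the rows above.  WHY IT MIGHT FAIL: only through gap (γ).  WHY NOVEL (att-p4/att-p5): with this name the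
route's complete input ledger is BY NAME — rung `WAllNonCMAtTwoOffThetaHabitat` ⟸ PRINT¹⁰ + {`MultiplicityTwoAtLevelAtTwo`, `KernelLetterCarrierAtOddLevelAtTwo`,
`Rank1Residual.GreenbergMuConjectureIrreducible`, `SchneiderLeadingTermFormulaAtTwoSq`} + residual (p735839 §1), and on the certified-seed cell `BSDp W 2` ⟸
PRINT¹⁰ + the first, second and fourth + one decidable certificate (p735839 §3) — two of the three remaining conjecture-grade inputs are `∀`-sentences about
the `2`-torsion of `J₀(L)` at odd `L`.

FILED AS A LEAF (imports `F1Sign2.KernelLetterCarrierAtTwo` + the Literature joint structure only; no consumer is imported, so the `Theorems/` lineage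
may import THIS file and restate its ledgers with `(hKLCLo : KernelLetterCarrierAtOddLevelAtTwo)`).  REF1-AUDIT §229 (-ref1 g21, 2026-08-29T18:39Z,
`REF1-data/b229/Probe229b.lean` 77d954426643ca61 rc 0, BC7 a–e sorry-free; FOLDED AS TEXT by the typer): **SURVIVES A1–A6 + junk-∃ (A2b/A4) + BC7** — the `∃`-over-interface is
the RIGHT polarity and NOT junk-dischargeable (any proof must PRODUCE a `ModularJacobianGaloisDataWithFormsAndPairing L ι` at every odd `L`: kernel `nonempty_of_carrier`;
`galAct := 1` fails `jacobiMap_galAct`; junk `M = ⊤ / ⊥` die on the (W1)_L hypotheses as in §177/§181); strictly WEAKER than v28's `∀ J`-form modulo PRINT existence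
(kernels `of_forall_form`, `nonempty_of_eichlerShimura`); guard `¬ 2 ∣ L` = T181d (kernel `carrier_false_of_even`).  R229a (placement gloss, non-blocking): the rows reference
`Dj` ONLY via `Dj.pairingTwo` (one occurrence, `⊥`-closedness; `galAct` none — kernel `carrier_congr`), so the node asserts the rows for SOME admissible (`𝕋`-balanced,
perfect, symmetric, invariant) pairing and SOME half-subgroup `M` — read «for an admissible pairing», not necessarily the `w_L`-Weil pairing and `J₀(L)[2]⁰`; safe for the
route (a weaker hypothesis of the kernel-checked consumers; §186 stands), and a prover may exploit it; the socle-`8` row and (W0′) are pairing-free.  (The binder itself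
was REF1 §186-audited as a hypothesis of p705426/p708118 and §181 Part B as a carrier.)  Typer -ty g20.
bears_on: `stmt-BirchSwinnertonDyer-22296` (C1; (R2) at unequal AND equal conductors via p727366), `stmt-BirchSwinnertonDyer-22298` (C2, att-p5's planes).
-/

open scoped NumberField Classical
open Literature.NumberTheory.EllipticCurves Literature.NumberTheory.EllipticCurves.ModularForms

noncomputable section

namespace Summit.BirchSwinnertonDyer.Rank1Residual.F1Sign2

/-- **`KernelLetterCarrierAtOddLevelAtTwo`** — the binder `hKLCLo` of the C1 22296 composition files (p727366 §1–§3, p734451, p735839 §1–§3, p735967;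
LINE v31 stub `stub_kernelLetterCarrierAtOddLevel`), VERBATIM: for every ODD level `L` and every `ι : ℚ̄ →+* ℂ` there is a joint `ℚ`-structure
`Dj : ModularJacobianGaloisDataWithFormsAndPairing L ι` of `J₀(L)` (one `galAct`, forms-equivariant, with the symmetric `galAct`-invariant Hecke-balanced
perfect pairing on `J₀(L)[2]`) whose underlying `ModularJacobianGaloisDataWithPairing` carries the level-`L` kernel-letter carrier
`KernelLetterCarrierAtLevelAtTwo L ι ·` ((W0′-forms) connected-part functoriality under every lattice-compatible rational form's Jacobi map to a good-ordinary `W`;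
(W1)_L for every Kilford-stratum `W` and every two-element-quotient eigen-ideal `𝔪 ∣ 2` of `W` in `𝕋_ℤ(L)` with `finrank_{𝕋/𝔪} J₀(L)[𝔪] = 4`: the multiplicative
part is `⊥`-closed inside `J₀(L)[𝔪]` and meets it in a cyclic socle set of exactly `8` elements).  `∃` over the hypothesis structure (SOME datum — the true Galois
action is the intended one; existence of a datum at all is the PRINT fact `exists_modularJacobianGaloisDataWithFormsAndPairing_eichlerShimura`); ODD `L` only
(the carrier is false at even `L` by design, REF1 §181 T181d).  Conjecture-grade with gap (γ) = (i) Wiese's Situation II transferred `J₁(L) → J₀(L)` at an ordinary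
non-Eisenstein `𝔪 ∣ 2` [cite: Wiese2007Multiplicities, Situation II, Thm. 2.1, Prop. 2.2, Cor. 4.2], (ii) `r = 2` taken as hypothesis
[cite: KilfordWiese2008, Thm. 1.3, Cor. 1.6, Question 1.9]; folklore rows [cite: Gross1990, p. 485, Props. 12.8–12.9]
[cite: DarmonDiamondTaylor1995, §1.5 (p. 38), §1.6 Lemma 1.38 (p. 41), §1.7 Def. 1.44 and Lemma 1.46 (p. 44–45), §4.4 (4.4.2)] [cite: ShimuraIATAF1971, Thm. 7.14].
Census 74/74 + 43/43 + 36/36 (33/33) + 127/127; `lcm`-shape levels: `d = 4` at all five ALIGN3 levels with `ψ ≤ 64 000` (39221, 42755, 36939, 47785, 41979; att-p3 g22), socle count there not run.  Unfolds definitionally to the binder (feed consumers by name).  Beyond-print theorem: no;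
BSD is not proved by this; closes nothing. -/
@[conjecture] def KernelLetterCarrierAtOddLevelAtTwo : Prop :=
  ∀ (L : ℕ) [NeZero L], ¬ 2 ∣ L → ∀ (ι : AlgebraicClosure ℚ →+* ℂ),
    ∃ Dj : ModularJacobianGaloisDataWithFormsAndPairing L ι,
      KernelLetterCarrierAtLevelAtTwo L ι Dj.toModularJacobianGaloisDataWithPairing

end Summit.BirchSwinnertonDyer.Rank1Residual.F1Sign2

end
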